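import Literature.AnabelianGeometry.SemiGraphs.GraphCoveringObject
import Literature.AnabelianGeometry.SemiGraphs.GraphOfAnabelioidsComplements
import Literature.AnabelianGeometry.SemiGraphs.GraphOfAnabelioidsLimits
import Literature.AnabelianGeometry.SemiGraphs.SubdivisionLemmas
import Literature.AnabelianGeometry.SemiGraphs.SemiGraphLocal
import Literature.AnabelianGeometry.Anabelioids.TrivialObjectSections
import Literature.AnabelianGeometry.Anabelioids.ExactFunctorProofs

/-!
# A connected graph-covering gives a connected object of `B(𝒢)` ([SemiAnbd] §2 p. 23; Prop. 2.6 p. 29)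

Mochizuki, *Semi-graphs of anabelioids*, Publ. RIMS **42** (2006) 221–322, §2
[cite: MochizukiSemiAnbd2006, Prop. 2.6 p.29]: in the proof of Proposition 2.6 the finite
graph-covering `𝔾′ → 𝔾` "may be assumed to be connected over `L`", and the contradiction comes from
the transitive action of `Π_ℍ` on the corresponding finite `Π_𝒢`-set — i.e. from the fact that a
covering of semi-graphs which is CONNECTED gives a CONNECTED object of `B(𝒢)` (p. 23: the vertices
and edges of the covering are the connected components of the constituent objects).  This file
proves it: `isConnected_coveringObj` — for a graph-covering `ψ : 𝔾′ → 𝔾` with finite fibres and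
`𝔾′` a connected graph, the object `coveringObj ψ` of `B(𝒢)` (`GraphCoveringObject.lean`) is
connected in the sense of Mathlib's `PreGaloisCategory.IsConnected` (not initial, and every
monomorphism into it from a non-initial object is an isomorphism).

Proof.  A monomorphism `m : Y ↪ coveringObj ψ` contains, over each constituent, a set of sheets
("`1 ⟶_j ∐ 1` factors through `m_v`"; `TrivialObjectSections.lean`).  Along a branch `b` of `e`
abutting to `v` the sheets of `Y_v` and of `Y_e` correspond under the branch bijection
(`factors_iff_of_branch`: the gluing square of `m` at `b`, read on the fibre functor `b^* ⋙ F_e`).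
Hence "the sheet lies in `Y`" is constant along the barycentric subdivision of the connected `𝔾′`:
either no sheet lies in `Y` (then `Y` is initial) or all do (then `m` is an isomorphism).
No definitions.
-/

namespace Literature.AnabelianGeometry.SemiGraphs

namespace SemiGraphOfAnabelioids

open CategoryTheory CategoryTheory.Limits CategoryTheory.PreGaloisCategory
open Literature.AnabelianGeometry.Anabelioids

universe v₁ u₁ u

variable (𝒢 : SemiGraphOfAnabelioids.{v₁, u₁, u}) {G' : SemiGraph.{u}} {ψ : G' ⟶ 𝒢.graph}

/-! ### Componentwise initial objects and isomorphisms of `B(𝒢)` -/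

/-- An object of `B(𝒢)` all of whose vertex and edge objects are initial is initial.
[cite: MochizukiSemiAnbd2006, Def. 2.1 p.23] -/
private theorem isInitial_of_components (Y : 𝒢.BObj) (hS : ∀ v, IsInitial (Y.S v))
    (hT : ∀ e, IsInitial (Y.T e)) : Nonempty (IsInitial Y) := by
  refine ⟨IsInitial.ofUniqueHom (fun Z => ?_) ?_⟩
  · exact { fS := fun v => (hS v).to _
            fT := fun e => (hT e).to _
            comm := fun b v h => ((hS v).isInitialObj (𝒢.pull b v h).pullback).hom_ext _ _ }
  · intro Z f
    ext v
    · exact (hS v).hom_ext _ _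
    · exact (hT _).hom_ext _ _

/-- A morphism of `B(𝒢)` all of whose components are isomorphisms is an isomorphism.
[cite: MochizukiSemiAnbd2006, Def. 2.1 p.23] -/
private theorem isIso_of_components' {Y A : 𝒢.BObj} (m : Y ⟶ A) (hS : ∀ v, IsIso (m.fS v))
    (hT : ∀ e, IsIso (m.fT e)) : IsIso m := by
  refine ⟨⟨{ fS := fun v => inv (m.fS v), fT := fun e => inv (m.fT e), comm := fun b v h => ?_ },
    ?_, ?_⟩⟩
  · rw [CategoryTheory.Functor.map_inv, IsIso.inv_comp_eq, ← Category.assoc, IsIso.eq_comp_inv]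
    exact (m.comm b v h).symm
  · ext v <;> simp
  · ext v <;> simp

/-! ### Sheets of a subobject of the covering object along a branch -/

variable [∀ v, Finite (ψ.VertexFiber v)] [∀ e, Finite (ψ.EdgeFiber e)]
  (hψ : SemiGraph.IsExcision ψ) (hG' : G'.IsGraph)

/-- **Sheets correspond along a gluing square** (local form, serving `B(𝒢)` and every `B(𝒢_ℍ)`):
for a branch `b` of `e` abutting to `v`, monomorphisms `m_S : Y_S ↪ ∐_{ψ⁻¹ v} 1` in `𝒢_v` and
`m_T : Y_T ↪ ∐_{ψ⁻¹ e} 1` in `𝒢_e`, and an isomorphism `φ : b^* Y_S ≅ Y_T` compatible with the gluing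
isomorphism of `coveringObj ψ` at `b`, the sheet `j` lies in `Y_S` iff the corresponding sheet
(branch bijection) lies in `Y_T`.  Proof: read both conditions on the fibre functors `b^* ⋙ F_e` and
`F_e` (`TrivialObjectSections.lean`). [cite: MochizukiSemiAnbd2006, Prop. 2.6 p.29] -/
private theorem factors_iff_of_gluing (b : 𝒢.graph.Branch) (v : 𝒢.graph.Vertex)
    (h : 𝒢.graph.abuts b = some v) {YS : 𝒢.V v} {YT : 𝒢.E (𝒢.graph.edgeOf b)}
    (mS : YS ⟶ ∐ fun _ : ψ.VertexFiber v => ⊤_ (𝒢.V v)) (_ : Mono mS)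
    (mT : YT ⟶ ∐ fun _ : ψ.EdgeFiber (𝒢.graph.edgeOf b) => ⊤_ (𝒢.E (𝒢.graph.edgeOf b)))
    (_ : Mono mT) (φ : (𝒢.pull b v h).pullback.obj YS ≅ YT)
    (hsq : (𝒢.pull b v h).pullback.map mS ≫ (𝒢.coveringGluing hψ hG' b v h).hom = φ.hom ≫ mT)
    (j : ψ.VertexFiber v) :
    (∃ f : ⊤_ (𝒢.V v) ⟶ YS, f ≫ mS = Sigma.ι (fun _ : ψ.VertexFiber v => ⊤_ (𝒢.V v)) j) ↔
      ∃ g : ⊤_ (𝒢.E (𝒢.graph.edgeOf b)) ⟶ YT, g ≫ mT =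
        Sigma.ι (fun _ : ψ.EdgeFiber (𝒢.graph.edgeOf b) => ⊤_ (𝒢.E (𝒢.graph.edgeOf b)))
          (SemiGraph.Hom.fiberEquivOfBranch hψ hG' b v h j) := by
  -- fibre functors: `F_e` on `𝒢_e` and `b^* ⋙ F_e` on `𝒢_v`
  let Fe := GaloisCategory.getFiberFunctor (𝒢.E (𝒢.graph.edgeOf b))
  let P := (𝒢.pull b v h).pullback
  haveI : FiberFunctor (P ⋙ Fe) := fiberFunctor_comp_of_exact P Fe
  haveI : Subsingleton (Fe.obj (⊤_ (𝒢.E (𝒢.graph.edgeOf b)))) := subsingleton_fiber_terminal Fe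
  obtain ⟨te⟩ := (nonempty_equiv_fiber_terminal_punit Fe).map fun e => e.symm PUnit.unit
  obtain ⟨tv⟩ := (nonempty_equiv_fiber_terminal_punit (P ⋙ Fe)).map fun e => e.symm PUnit.unit
  refine (TrivialObj.factors_iff_mem_range (F := P ⋙ Fe) mS j tv).trans
    (Iff.trans ?_ (TrivialObj.factors_iff_mem_range (F := Fe) mT
      (SemiGraph.Hom.fiberEquivOfBranch hψ hG' b v h j) te).symm)
  -- the sheet `j` of `S_v` is carried to the sheet `β j` of `T_e` by the gluing, on the fibre
  have key : Fe.map (𝒢.coveringGluing hψ hG' b v h).hom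
      ((P ⋙ Fe).map (Sigma.ι (fun _ : ψ.VertexFiber v => ⊤_ (𝒢.V v)) j) tv) =
      Fe.map (Sigma.ι (fun _ : ψ.EdgeFiber (𝒢.graph.edgeOf b) => ⊤_ (𝒢.E (𝒢.graph.edgeOf b)))
        (SemiGraph.Hom.fiberEquivOfBranch hψ hG' b v h j)) te := by
    rw [Subsingleton.elim te (Fe.map (PreservesTerminal.iso P).hom tv)]
    change (Fe.map (P.map _) ≫ Fe.map _) tv = (Fe.map _ ≫ Fe.map _) tv
    rw [← Fe.map_comp, ← Fe.map_comp, 𝒢.map_ι_comp_coveringGluing_hom hψ hG' b v h j]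
  constructor
  · rintro ⟨y, hy⟩
    -- `y : F_e (b^* Y_S)`; push it through `φ` to `F_e (Y_T)`
    refine ⟨Fe.map φ.hom y, ?_⟩
    rw [← key]
    change (Fe.map φ.hom ≫ Fe.map mT) y = _
    rw [← Fe.map_comp, ← hsq, Fe.map_comp]
    change Fe.map (𝒢.coveringGluing hψ hG' b v h).hom (Fe.map (P.map mS) y) = _
    have hy' : Fe.map (P.map mS) y =
        (P ⋙ Fe).map (Sigma.ι (fun _ : ψ.VertexFiber v => ⊤_ (𝒢.V v)) j) tv := hy
    rw [hy']
  · rintro ⟨z, hz⟩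
    refine ⟨Fe.map φ.inv z, ?_⟩
    -- apply the injective map `F_e (ψ_b)` to both sides
    have hinj : Function.Injective (Fe.map (𝒢.coveringGluing hψ hG' b v h).hom) :=
      ((FintypeCat.incl.mapIso (Fe.mapIso (𝒢.coveringGluing hψ hG' b v h))).toEquiv).injective
    apply hinj
    rw [key, ← hz]
    change (Fe.map (P.map mS) ≫ Fe.map (𝒢.coveringGluing hψ hG' b v h).hom) (Fe.map φ.inv z) = _
    rw [← Fe.map_comp, hsq, Fe.map_comp]
    change Fe.map mT ((Fe.map φ.inv ≫ Fe.map φ.hom) z) = _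
    rw [← Fe.map_comp, Iso.inv_hom_id, CategoryTheory.Functor.map_id]
    rfl

/-! ### The main theorem -/

/-- **A connected graph-covering gives a connected covering object**: for a graph-covering
`ψ : 𝔾′ → 𝔾` with finite fibres and `𝔾′` a connected graph, `coveringObj ψ` is a connected
object of `B(𝒢)`. [cite: MochizukiSemiAnbd2006, Prop. 2.6 p.29] -/
theorem isConnected_coveringObj (hconn : G'.IsConnected) :
    PreGaloisCategory.IsConnected (𝒢.coveringObj hψ hG') := by
  classical
  constructor
  · -- not initial: `𝔾′` has a node, whose constituent `∐_{fibre} 1` is then not initial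
    intro hI
    obtain ⟨x₀⟩ := hconn.connected.nonempty
    have hρ := (𝒢.hasColimitsOfShape_bObj (J := Discrete PEmpty.{1})).2
    rcases x₀ with v' | e' | b'
    · haveI := hρ.1 (ψ.vertexMap v')
      exact TrivialObj.not_isInitial (C := 𝒢.V (ψ.vertexMap v')) (⟨v', rfl⟩ : ψ.VertexFiber _)
        (hI.isInitialObj (𝒢.ρ (ψ.vertexMap v')) _)
    · haveI := hρ.2 (ψ.edgeMap e')
      exact TrivialObj.not_isInitial (C := 𝒢.E (ψ.edgeMap e')) (⟨e', rfl⟩ : ψ.EdgeFiber _)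
        (hI.isInitialObj (𝒢.ρE (ψ.edgeMap e')) _)
    · haveI := hρ.2 (ψ.edgeMap (G'.edgeOf b'))
      exact TrivialObj.not_isInitial (C := 𝒢.E (ψ.edgeMap (G'.edgeOf b')))
        (⟨G'.edgeOf b', rfl⟩ : ψ.EdgeFiber _) (hI.isInitialObj (𝒢.ρE (ψ.edgeMap (G'.edgeOf b'))) _)
  · intro Y m _ hY
    -- the sheet predicates: `PV v j` / `PE e j` = "the sheet `j` lies in `Y`"
    obtain ⟨PV, hPV⟩ : ∃ PV : ∀ v : 𝒢.graph.Vertex, ψ.VertexFiber v → Prop, ∀ v j, PV v j ↔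
        ∃ f : ⊤_ (𝒢.V v) ⟶ Y.S v, f ≫ m.fS v = Sigma.ι (fun _ : ψ.VertexFiber v => ⊤_ (𝒢.V v)) j :=
      ⟨_, fun _ _ => Iff.rfl⟩
    obtain ⟨PE, hPE⟩ : ∃ PE : ∀ e : 𝒢.graph.Edge, ψ.EdgeFiber e → Prop, ∀ e j, PE e j ↔
        ∃ g : ⊤_ (𝒢.E e) ⟶ Y.T e, g ≫ m.fT e = Sigma.ι (fun _ : ψ.EdgeFiber e => ⊤_ (𝒢.E e)) j :=
      ⟨_, fun _ _ => Iff.rfl⟩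
    have hPE_congr : ∀ {e₁ e₂ : 𝒢.graph.Edge} (_ : e₁ = e₂) (j₁ : ψ.EdgeFiber e₁)
        (j₂ : ψ.EdgeFiber e₂), j₁.1 = j₂.1 → (PE e₁ j₁ ↔ PE e₂ j₂) := by
      rintro e₁ _ rfl j₁ j₂ hj
      obtain rfl : j₁ = j₂ := Subtype.ext hj
      exact Iff.rfl
    -- the branch step: along a branch `b′` of `𝔾′` abutting to `v′`
    have hbranch : ∀ (b' : G'.Branch) (v' : G'.Vertex) (_ : G'.abuts b' = some v'),
        PE (ψ.edgeMap (G'.edgeOf b')) ⟨G'.edgeOf b', rfl⟩ ↔ PV (ψ.vertexMap v') ⟨v', rfl⟩ := by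
      intro b' v' h'
      have h := ψ.abuts_branchMap b' v' h'
      have hb' : b' = (SemiGraph.Hom.branchLift hψ (ψ.branchMap b') (ψ.vertexMap v') h ⟨v', rfl⟩).1 :=
        SemiGraph.Hom.eq_branchLift hψ _ _ h ⟨v', rfl⟩ b' h' rfl
      refine Iff.trans ?_ ((hPV _ _).trans
        (factors_iff_of_gluing 𝒢 hψ hG' (ψ.branchMap b') (ψ.vertexMap v') h (m.fS _)
          (𝒢.mono_fS m _) (m.fT _) (𝒢.mono_fT m _) (Y.ψ _ _ h) (m.comm _ _ h) ⟨v', rfl⟩)).symm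
      refine (hPE_congr (ψ.edgeOf_branchMap b').symm _
        (SemiGraph.Hom.fiberEquivOfBranch hψ hG' _ _ h ⟨v', rfl⟩) ?_).trans (hPE _ _)
      rw [SemiGraph.Hom.fiberEquivOfBranch_apply_val, ← hb']
    -- "the sheet through the node lies in `Y`", a predicate on the subdivision of `𝔾′`
    obtain ⟨Q, hQv, hQe, hQb⟩ : ∃ Q : G'.Node → Prop,
        (∀ v', Q (Sum.inl v') ↔ PV (ψ.vertexMap v') ⟨v', rfl⟩) ∧
        (∀ e', Q (Sum.inr (Sum.inl e')) ↔ PE (ψ.edgeMap e') ⟨e', rfl⟩) ∧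
        (∀ b', Q (Sum.inr (Sum.inr b')) ↔ PE (ψ.edgeMap (G'.edgeOf b')) ⟨G'.edgeOf b', rfl⟩) :=
      ⟨Sum.elim (fun v' => PV (ψ.vertexMap v') ⟨v', rfl⟩)
        (Sum.elim (fun e' => PE (ψ.edgeMap e') ⟨e', rfl⟩)
          (fun b' => PE (ψ.edgeMap (G'.edgeOf b')) ⟨G'.edgeOf b', rfl⟩)),
        fun _ => Iff.rfl, fun _ => Iff.rfl, fun _ => Iff.rfl⟩
    -- … which is constant along incidences, hence constant (the subdivision is connected)
    have hrel : ∀ {x y : G'.Node}, G'.NodeRel x y → (Q x ↔ Q y) := by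
      rintro _ _ (⟨b'⟩ | ⟨b', v', h'⟩)
      · exact (hQe _).trans (hQb _).symm
      · exact (hQb _).trans ((hbranch b' v' h').trans (hQv _).symm)
    have hadj : ∀ {x y : G'.Node}, G'.subdivision.Adj x y → (Q x ↔ Q y) := fun hxy =>
      ((G'.subdivision_adj_iff).mp hxy).elim (fun h => hrel h) (fun h => (hrel h).symm)
    have hwalk : ∀ {x y : G'.Node} (_ : G'.subdivision.Walk x y), (Q x ↔ Q y) := by
      intro x y p
      induction p with
      | nil => exact Iff.rfl
      | cons hxy _ ih => exact (hadj hxy).trans ih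
    have hconst : ∀ x y : G'.Node, (Q x ↔ Q y) := fun x y => by
      obtain ⟨p⟩ := hconn.connected.preconnected x y
      exact hwalk p
    obtain ⟨x₀⟩ := hconn.connected.nonempty
    by_cases h0 : Q x₀
    · -- every sheet lies in `Y`: all the components of `m` are isomorphisms
      have hV : ∀ (v : 𝒢.graph.Vertex) (j : ψ.VertexFiber v), PV v j := by
        rintro v ⟨v', rfl⟩
        exact (hQv v').mp ((hconst _ _).mp h0)
      have hE : ∀ (e : 𝒢.graph.Edge) (j : ψ.EdgeFiber e), PE e j := by
        rintro e ⟨e', rfl⟩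
        exact (hQe e').mp ((hconst _ _).mp h0)
      have hS : ∀ v, IsIso (m.fS v) := fun v =>
        haveI : @Mono _ _ (Y.S v) (∐ fun _ : ψ.VertexFiber v => ⊤_ (𝒢.V v)) (m.fS v) :=
          𝒢.mono_fS m v
        TrivialObj.isIso_of_forall_factors (m.fS v) fun j => (hPV v j).mp (hV v j)
      have hT : ∀ e, IsIso (m.fT e) := fun e =>
        haveI : @Mono _ _ (Y.T e) (∐ fun _ : ψ.EdgeFiber e => ⊤_ (𝒢.E e)) (m.fT e) :=
          𝒢.mono_fT m e
        TrivialObj.isIso_of_forall_factors (m.fT e) fun j => (hPE e j).mp (hE e j)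
      exact isIso_of_components' 𝒢 m hS hT
    · -- no sheet lies in `Y`: all the components of `Y` are initial, so `Y` is initial
      have hV : ∀ (v : 𝒢.graph.Vertex) (j : ψ.VertexFiber v), ¬ PV v j := by
        rintro v ⟨v', rfl⟩ hv
        exact h0 ((hconst _ _).mpr ((hQv v').mpr hv))
      have hE : ∀ (e : 𝒢.graph.Edge) (j : ψ.EdgeFiber e), ¬ PE e j := by
        rintro e ⟨e', rfl⟩ he
        exact h0 ((hconst _ _).mpr ((hQe e').mpr he))
      have hS : ∀ v, Nonempty (IsInitial (Y.S v)) := fun v =>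
        haveI : @Mono _ _ (Y.S v) (∐ fun _ : ψ.VertexFiber v => ⊤_ (𝒢.V v)) (m.fS v) :=
          𝒢.mono_fS m v
        TrivialObj.isInitial_of_forall_not_factors (m.fS v) fun j hj => hV v j ((hPV v j).mpr hj)
      have hT : ∀ e, Nonempty (IsInitial (Y.T e)) := fun e =>
        haveI : @Mono _ _ (Y.T e) (∐ fun _ : ψ.EdgeFiber e => ⊤_ (𝒢.E e)) (m.fT e) :=
          𝒢.mono_fT m e
        TrivialObj.isInitial_of_forall_not_factors (m.fT e) fun j hj => hE e j ((hPE e j).mpr hj)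
      obtain ⟨hI⟩ := isInitial_of_components 𝒢 Y (fun v => (hS v).some) (fun e => (hT e).some)
      exact (hY hI).elim

/-! ### The restricted form: connected over `ℍ` gives connected in `B(𝒢_ℍ)` -/

/-- **A graph-covering that is connected over `ℍ` gives a connected object of `B(𝒢_ℍ)`**
([SemiAnbd] p. 29: "connected over `L`", and the transitivity of `Π_ℍ` used there): for a
graph-covering `ψ : 𝔾′ → 𝔾` with finite fibres, `𝔾′` a graph, and a sub-semi-graph `ℍ ⊆ 𝔾` whose
inverse image `ψ⁻¹(ℍ) ⊆ 𝔾′` is a connected sub-semi-graph, the restriction of `coveringObj ψ` to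
`B(𝒢_ℍ)` is connected. [cite: MochizukiSemiAnbd2006, Prop. 2.6 p.29] -/
theorem isConnected_restrictFunctor_coveringObj (H : 𝒢.graph.Subgraph)
    (hconn : (⟨ψ.vertexMap ⁻¹' H.verts, ψ.edgeMap ⁻¹' H.edges⟩ : G'.Subgraph).toSemiGraph.IsConnected) :
    PreGaloisCategory.IsConnected ((𝒢.restrictFunctor H).obj (𝒢.coveringObj hψ hG')) := by
  classical
  constructor
  · -- not initial: `ψ⁻¹(ℍ)` has a node, whose constituent `∐_{fibre} 1` is then not initial
    intro hI
    obtain ⟨x₀⟩ := hconn.connected.nonempty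
    have hρ := ((𝒢.restrict H).hasColimitsOfShape_bObj (J := Discrete PEmpty.{1})).2
    rcases x₀ with v' | e' | b'
    · haveI := hρ.1 ⟨ψ.vertexMap v'.1, v'.2⟩
      exact TrivialObj.not_isInitial (C := (𝒢.restrict H).V ⟨ψ.vertexMap v'.1, v'.2⟩)
        (⟨v'.1, rfl⟩ : ψ.VertexFiber _) (hI.isInitialObj ((𝒢.restrict H).ρ ⟨ψ.vertexMap v'.1, v'.2⟩) _)
    · haveI := hρ.2 ⟨ψ.edgeMap e'.1, e'.2⟩
      exact TrivialObj.not_isInitial (C := (𝒢.restrict H).E ⟨ψ.edgeMap e'.1, e'.2⟩)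
        (⟨e'.1, rfl⟩ : ψ.EdgeFiber _) (hI.isInitialObj ((𝒢.restrict H).ρE ⟨ψ.edgeMap e'.1, e'.2⟩) _)
    · haveI := hρ.2 ⟨ψ.edgeMap (G'.edgeOf b'.1), b'.2⟩
      exact TrivialObj.not_isInitial (C := (𝒢.restrict H).E ⟨ψ.edgeMap (G'.edgeOf b'.1), b'.2⟩)
        (⟨G'.edgeOf b'.1, rfl⟩ : ψ.EdgeFiber _)
        (hI.isInitialObj ((𝒢.restrict H).ρE ⟨ψ.edgeMap (G'.edgeOf b'.1), b'.2⟩) _)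
  · intro Y m _ hY
    -- the sheet predicates over the vertices / edges of `ℍ`
    obtain ⟨PV, hPV⟩ : ∃ PV : ∀ w : H.toSemiGraph.Vertex, ψ.VertexFiber w.1 → Prop, ∀ w j, PV w j ↔
        ∃ f : ⊤_ (𝒢.V w.1) ⟶ Y.S w,
          f ≫ m.fS w = Sigma.ι (fun _ : ψ.VertexFiber w.1 => ⊤_ (𝒢.V w.1)) j :=
      ⟨_, fun _ _ => Iff.rfl⟩
    obtain ⟨PE, hPE⟩ : ∃ PE : ∀ e : H.toSemiGraph.Edge, ψ.EdgeFiber e.1 → Prop, ∀ e j, PE e j ↔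
        ∃ g : ⊤_ (𝒢.E e.1) ⟶ Y.T e,
          g ≫ m.fT e = Sigma.ι (fun _ : ψ.EdgeFiber e.1 => ⊤_ (𝒢.E e.1)) j :=
      ⟨_, fun _ _ => Iff.rfl⟩
    have hPE_congr : ∀ {e₁ e₂ : H.toSemiGraph.Edge} (_ : e₁ = e₂) (j₁ : ψ.EdgeFiber e₁.1)
        (j₂ : ψ.EdgeFiber e₂.1), j₁.1 = j₂.1 → (PE e₁ j₁ ↔ PE e₂ j₂) := by
      rintro e₁ _ rfl j₁ j₂ hj
      obtain rfl : j₁ = j₂ := Subtype.ext hj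
      exact Iff.rfl
    -- the branch step: along a branch `b′` of `ψ⁻¹(ℍ)` abutting to `v′`
    have hbranch : ∀ (b' : G'.Branch) (hb' : ψ.edgeMap (G'.edgeOf b') ∈ H.edges) (v' : G'.Vertex)
        (hv' : ψ.vertexMap v' ∈ H.verts) (_ : G'.abuts b' = some v'),
        PE ⟨ψ.edgeMap (G'.edgeOf b'), hb'⟩ ⟨G'.edgeOf b', rfl⟩ ↔ PV ⟨ψ.vertexMap v', hv'⟩ ⟨v', rfl⟩ := by
      intro b' hb' v' hv' h'
      -- the branch `ψ b′` of `ℍ` and the vertex `ψ v′` of `ℍ` it abuts to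
      have hb : 𝒢.graph.edgeOf (ψ.branchMap b') ∈ H.edges := by
        rw [ψ.edgeOf_branchMap]; exact hb'
      have hβ : H.toSemiGraph.abuts ⟨ψ.branchMap b', hb⟩ = some ⟨ψ.vertexMap v', hv'⟩ :=
        (SemiGraph.Subgraph.abuts_eq_some_iff H _ _).mpr (ψ.abuts_branchMap b' v' h')
      have h : 𝒢.graph.abuts (ψ.branchMap b') = some (ψ.vertexMap v') :=
        H.ι.abuts_branchMap _ _ hβ
      have hlift : b' = (SemiGraph.Hom.branchLift hψ (ψ.branchMap b') (ψ.vertexMap v') h ⟨v', rfl⟩).1 :=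
        SemiGraph.Hom.eq_branchLift hψ _ _ h ⟨v', rfl⟩ b' h' rfl
      -- the gluing square of `m` at this branch of `ℍ` (the `b_*` of `𝒢_ℍ` is that of `𝒢`)
      have hsq : (𝒢.pull (ψ.branchMap b') (ψ.vertexMap v') h).pullback.map
            (m.fS ⟨ψ.vertexMap v', hv'⟩) ≫ (𝒢.coveringGluing hψ hG' _ _ h).hom =
          (Y.ψ ⟨ψ.branchMap b', hb⟩ ⟨ψ.vertexMap v', hv'⟩ hβ).hom ≫
            m.fT ⟨𝒢.graph.edgeOf (ψ.branchMap b'), hb⟩ :=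
        m.comm ⟨ψ.branchMap b', hb⟩ ⟨ψ.vertexMap v', hv'⟩ hβ
      refine Iff.trans ?_ ((hPV ⟨ψ.vertexMap v', hv'⟩ ⟨v', rfl⟩).trans
        (factors_iff_of_gluing 𝒢 hψ hG' (ψ.branchMap b') (ψ.vertexMap v') h
          (m.fS ⟨ψ.vertexMap v', hv'⟩) ((𝒢.restrict H).mono_fS m _)
          (m.fT ⟨𝒢.graph.edgeOf (ψ.branchMap b'), hb⟩) ((𝒢.restrict H).mono_fT m _)
          (Y.ψ ⟨ψ.branchMap b', hb⟩ ⟨ψ.vertexMap v', hv'⟩ hβ) hsq ⟨v', rfl⟩)).symm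
      refine (@hPE_congr ⟨ψ.edgeMap (G'.edgeOf b'), hb'⟩ ⟨𝒢.graph.edgeOf (ψ.branchMap b'), hb⟩
        (Subtype.ext (ψ.edgeOf_branchMap b').symm) ⟨G'.edgeOf b', rfl⟩
        (SemiGraph.Hom.fiberEquivOfBranch hψ hG' (ψ.branchMap b') (ψ.vertexMap v') h ⟨v', rfl⟩)
        ?_).trans
          (hPE ⟨𝒢.graph.edgeOf (ψ.branchMap b'), hb⟩
            (SemiGraph.Hom.fiberEquivOfBranch hψ hG' (ψ.branchMap b') (ψ.vertexMap v') h ⟨v', rfl⟩))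
      rw [SemiGraph.Hom.fiberEquivOfBranch_apply_val, ← hlift]
    -- "the sheet through the node lies in `Y`", a predicate on the subdivision of `ψ⁻¹(ℍ)`
    obtain ⟨Q, hQv, hQe, hQb⟩ : ∃ Q : (⟨ψ.vertexMap ⁻¹' H.verts, ψ.edgeMap ⁻¹' H.edges⟩ :
          G'.Subgraph).toSemiGraph.Node → Prop,
        (∀ v', Q (Sum.inl v') ↔ PV ⟨ψ.vertexMap v'.1, v'.2⟩ ⟨v'.1, rfl⟩) ∧
        (∀ e', Q (Sum.inr (Sum.inl e')) ↔ PE ⟨ψ.edgeMap e'.1, e'.2⟩ ⟨e'.1, rfl⟩) ∧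
        (∀ b', Q (Sum.inr (Sum.inr b')) ↔
          PE ⟨ψ.edgeMap (G'.edgeOf b'.1), b'.2⟩ ⟨G'.edgeOf b'.1, rfl⟩) :=
      ⟨Sum.elim (fun v' => PV ⟨ψ.vertexMap v'.1, v'.2⟩ ⟨v'.1, rfl⟩)
        (Sum.elim (fun e' => PE ⟨ψ.edgeMap e'.1, e'.2⟩ ⟨e'.1, rfl⟩)
          (fun b' => PE ⟨ψ.edgeMap (G'.edgeOf b'.1), b'.2⟩ ⟨G'.edgeOf b'.1, rfl⟩)),
        fun _ => Iff.rfl, fun _ => Iff.rfl, fun _ => Iff.rfl⟩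
    -- … which is constant along incidences, hence constant (the subdivision is connected)
    have hrel : ∀ {x y}, (⟨ψ.vertexMap ⁻¹' H.verts, ψ.edgeMap ⁻¹' H.edges⟩ :
        G'.Subgraph).toSemiGraph.NodeRel x y → (Q x ↔ Q y) := by
      rintro _ _ (⟨b'⟩ | ⟨b', v', h'⟩)
      · exact (hQe _).trans (hQb _).symm
      · exact (hQb _).trans ((hbranch b'.1 b'.2 v'.1 v'.2
          ((SemiGraph.Subgraph.abuts_eq_some_iff _ b' v').mp h')).trans (hQv _).symm)
    have hadj : ∀ {x y}, (⟨ψ.vertexMap ⁻¹' H.verts, ψ.edgeMap ⁻¹' H.edges⟩ :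
        G'.Subgraph).toSemiGraph.subdivision.Adj x y → (Q x ↔ Q y) := fun hxy =>
      ((SemiGraph.subdivision_adj_iff _).mp hxy).elim (fun h => hrel h) (fun h => (hrel h).symm)
    have hwalk : ∀ {x y} (_ : (⟨ψ.vertexMap ⁻¹' H.verts, ψ.edgeMap ⁻¹' H.edges⟩ :
        G'.Subgraph).toSemiGraph.subdivision.Walk x y), (Q x ↔ Q y) := by
      intro x y p
      induction p with
      | nil => exact Iff.rfl
      | cons hxy _ ih => exact (hadj hxy).trans ih
    have hconst : ∀ x y, (Q x ↔ Q y) := fun x y => by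
      obtain ⟨p⟩ := hconn.connected.preconnected x y
      exact hwalk p
    obtain ⟨x₀⟩ := hconn.connected.nonempty
    by_cases h0 : Q x₀
    · -- every sheet lies in `Y`: all the components of `m` are isomorphisms
      have hV : ∀ (w : H.toSemiGraph.Vertex) (j : ψ.VertexFiber w.1), PV w j := by
        rintro ⟨u, hw⟩ ⟨v', hv'⟩
        obtain rfl : ψ.vertexMap v' = u := hv'
        exact (hQv ⟨v', hw⟩).mp ((hconst _ _).mp h0)
      have hE : ∀ (e : H.toSemiGraph.Edge) (j : ψ.EdgeFiber e.1), PE e j := by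
        rintro ⟨u, he⟩ ⟨e', he'⟩
        obtain rfl : ψ.edgeMap e' = u := he'
        exact (hQe ⟨e', he⟩).mp ((hconst _ _).mp h0)
      have hS : ∀ w, IsIso (m.fS w) := fun w =>
        haveI : @Mono (𝒢.V w.1) _ (Y.S w) (∐ fun _ : ψ.VertexFiber w.1 => ⊤_ (𝒢.V w.1))
          (m.fS w) := (𝒢.restrict H).mono_fS m w
        TrivialObj.isIso_of_forall_factors (C := 𝒢.V w.1) (m.fS w) fun j => (hPV w j).mp (hV w j)
      have hT : ∀ e, IsIso (m.fT e) := fun e =>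
        haveI : @Mono (𝒢.E e.1) _ (Y.T e) (∐ fun _ : ψ.EdgeFiber e.1 => ⊤_ (𝒢.E e.1))
          (m.fT e) := (𝒢.restrict H).mono_fT m e
        TrivialObj.isIso_of_forall_factors (C := 𝒢.E e.1) (m.fT e) fun j => (hPE e j).mp (hE e j)
      exact isIso_of_components' (𝒢.restrict H) m hS hT
    · -- no sheet lies in `Y`: all the components of `Y` are initial, so `Y` is initial
      have hV : ∀ (w : H.toSemiGraph.Vertex) (j : ψ.VertexFiber w.1), ¬ PV w j := by
        rintro ⟨u, hw⟩ ⟨v', hv'⟩ hv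
        obtain rfl : ψ.vertexMap v' = u := hv'
        exact h0 ((hconst _ _).mpr ((hQv ⟨v', hw⟩).mpr hv))
      have hE : ∀ (e : H.toSemiGraph.Edge) (j : ψ.EdgeFiber e.1), ¬ PE e j := by
        rintro ⟨u, he⟩ ⟨e', he'⟩ hPe
        obtain rfl : ψ.edgeMap e' = u := he'
        exact h0 ((hconst _ _).mpr ((hQe ⟨e', he⟩).mpr hPe))
      have hS : ∀ w, Nonempty (IsInitial (Y.S w)) := fun w =>
        haveI : @Mono (𝒢.V w.1) _ (Y.S w) (∐ fun _ : ψ.VertexFiber w.1 => ⊤_ (𝒢.V w.1))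
          (m.fS w) := (𝒢.restrict H).mono_fS m w
        TrivialObj.isInitial_of_forall_not_factors (C := 𝒢.V w.1) (m.fS w)
          fun j hj => hV w j ((hPV w j).mpr hj)
      have hT : ∀ e, Nonempty (IsInitial (Y.T e)) := fun e =>
        haveI : @Mono (𝒢.E e.1) _ (Y.T e) (∐ fun _ : ψ.EdgeFiber e.1 => ⊤_ (𝒢.E e.1))
          (m.fT e) := (𝒢.restrict H).mono_fT m e
        TrivialObj.isInitial_of_forall_not_factors (C := 𝒢.E e.1) (m.fT e)
          fun j hj => hE e j ((hPE e j).mpr hj)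
      obtain ⟨hI⟩ := isInitial_of_components (𝒢.restrict H) Y (fun w => (hS w).some)
        (fun e => (hT e).some)
      exact (hY hI).elim

end SemiGraphOfAnabelioids

end Literature.AnabelianGeometry.SemiGraphs
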